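import Summits.ValiantsHypothesis.ValiantsHypothesis.Theorems.LacunarySymmetroidMatrixDescartesPivotRankOneCriticalWindowsParallelTwoChebyshev
import Summits.ValiantsHypothesis.ValiantsHypothesis.Theorems.LacunarySymmetroidMatrixDescartesPivotRankOneCriticalWindowsParallelReduction

/-!
# `MatrixDescartes` census — rank-one `(2,K)₁`: THE PARALLEL TWO-LETTER PER-SIDE LAW
# (a pivot letter and two PARALLEL letters beyond it ⇒ the window profile has AT MOST THREE critical directions — the first `n = 2` law)

HONEST FRAMING.  Object-search cell `pub-symmetroid`, seat `val-sym-mdr-p1` (generation 25); helper file `--supports` the crux item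
stmt-ValiantsHypothesis-18050 (`Theses.LacunarySymmetroid.MatrixDescartes`, OPEN, on HOLD) with NO closure claim.  ASSEMBLY of
`…ParallelReduction` (eliminant), `…ParallelTwoCertificate` (explicit `P, Q, R`, numerator identity) and `…ParallelTwoChebyshev`
(`no_three_zeros`).  SETTING (positions scaled so that the common position of the two upper letters is `1`): pivot letter `p` with weight
`wₚ`, position `c ∈ (0,1)`, exponent `dₚ < e` (`a = e − dₚ`); letters `j, k` at position `1` with exponents `e < d_j < d_k`
(`b₁ = d_j − e < b₂ = d_k − e`, `γ₁ = d_j − dₚ`, `γ₂ = d_k − dₚ`), weights `w_j, w_k > 0`; critical points `(x, T)` of the window profile with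
`c < T` (both critical equations).  MAIN THEOREM **`parallel_two_law`**: there are no four critical points with scales `x₁ < x₂ < x₃ < x₄`.
PROOF (kernel): at a critical point, `u := √((b₁W_j + b₂W_k)/(aWₚ))` satisfies the eliminant (`parallel_eliminant`), whence
`W_j/Wₚ = F₁(u)`, `W_k/Wₚ = F₂(u)` with `F₁ = G₁/((b₂−b₁)L₂)`, `F₂ = G₂/((b₂−b₁)L₂)`, `G₁ = b₂uL₁ − au²L₂`, `G₂ = au²L₂ − b₁uL₁`, `L₁ = 2c + (1+c)u`,
`L₂ = (1+c) + 2u` (§1); so the weight-free invariant `Φ(u) = F₁(u)^{γ₂}/F₂(u)^{γ₁}` takes the same value at `u₁ < u₂ < u₃ < u₄` (`u` increases with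
`x`); three Rolle steps give zeros `σ₁ < σ₂ < σ₃` of `Φ′`, i.e. of `K = γ₂F₁′F₂ − γ₁F₁F₂′` (`F₁, F₂ > 0` in between by convexity of the
defining quadratics); the identity **`key_identity`** `L₁²·K_num = −(b₂−b₁)·u·(b₁b₂P − a(b₁+b₂)Q + a²R)` turns them into three positive zeros of
the certificate's combination with `z = a² ≠ 0` — impossible by `no_three_zeros`.  COROLLARY (reading, with `…RootCount`/`…SideCount`):
the one-sided pencil «pivot + two parallel letters» has `Z₊ ≤ 4` from the analytic side (the tree's one-against-parallel law gives the same
number by Descartes; the point is the per-side COUNT `≤ 3`, sharp on the bare `K = 3` pencil, and the method, which is the template for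
non-parallel letters).  Nothing here bears on `MatrixDescartes` in its window, on `DoorA26` / `DoorA34`, registers / ζ, or `VP ≠ VNP`.

[folklore] Rolle, `HasDerivAt.pow/.div`, convexity of quadratics; the three companion files.  No definitions (local notation only), no named facts.
-/

-- `Summit.ValiantsHypothesis.ValiantsHypothesis.…` repeats a component by the D-0017 layout
-- (single-conjunct summit), which the `dupNamespace` linter flags; the name is mandated.
set_option linter.dupNamespace false

namespace Summit.ValiantsHypothesis.ValiantsHypothesis.Theorems.LacunarySymmetroidMatrixDescartes.Pivot.CriticalWindows.ParallelTwo

open Set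
open Summit.ValiantsHypothesis.ValiantsHypothesis.Theorems.LacunarySymmetroidMatrixDescartes.Pivot.CriticalWindows.Parallel
  (parallel_eliminant)

/-- The polynomial `𝐏(c,u)` of the certificate (explicit; local notation, no definition). -/
local notation3 (prettyPrint := false) "𝐏⟦" c ", " u "⟧" => (16 * c ^ (4 : ℕ) + 16 * c ^ (5 : ℕ) + 40 * c ^ (3 : ℕ) * u + 80 * c ^ (4 : ℕ) * u + 40 * c ^ (5 : ℕ) * u + 36 * c ^ (2 : ℕ) * u ^ (2 : ℕ) + 124 * c ^ (3 : ℕ) * u ^ (2 : ℕ) + 124 * c ^ (4 : ℕ) * u ^ (2 : ℕ) + 36 * c ^ (5 : ℕ) * u ^ (2 : ℕ) + 14 * c * u ^ (3 : ℕ) + 80 * c ^ (2 : ℕ) * u ^ (3 : ℕ) + 132 * c ^ (3 : ℕ) * u ^ (3 : ℕ) + 80 * c ^ (4 : ℕ) * u ^ (3 : ℕ) + 14 * c ^ (5 : ℕ) * u ^ (3 : ℕ) + 2 * u ^ (4 : ℕ) + 22 * c * u ^ (4 : ℕ) + 56 * c ^ (2 : ℕ) * u ^ (4 : ℕ) + 56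 * c ^ (3 : ℕ) * u ^ (4 : ℕ) + 22 * c ^ (4 : ℕ) * u ^ (4 : ℕ) + 2 * c ^ (5 : ℕ) * u ^ (4 : ℕ) + 2 * u ^ (5 : ℕ) + 8 * c * u ^ (5 : ℕ) + 12 * c ^ (2 : ℕ) * u ^ (5 : ℕ) + 8 * c ^ (3 : ℕ) * u ^ (5 : ℕ) + 2 * c ^ (4 : ℕ) * u ^ (5 : ℕ))

/-- The polynomial `𝐐(c,u)` of the certificate (explicit; local notation, no definition). -/
local notation3 (prettyPrint := false) "𝐐⟦" c ", " u "⟧" => (8 * c ^ (3 : ℕ) * u + 16 * c ^ (4 : ℕ) * u + 8 * c ^ (5 : ℕ) * u + 16 * c ^ (2 : ℕ) * u ^ (2 : ℕ) + 64 * c ^ (3 : ℕ) * u ^ (2 : ℕ) + 64 * c ^ (4 : ℕ) * u ^ (2 : ℕ) + 16 * c ^ (5 : ℕ) * u ^ (2 : ℕ) + 10 * c * u ^ (3 : ℕ) + 80 * c ^ (2 : ℕ) * u ^ (3 : ℕ) + 140 * c ^ (3 : ℕ) * u ^ (3 : ℕ) + 80 * c ^ (4 : ℕ) * u ^ (3 :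 ℕ) + 10 * c ^ (5 : ℕ) * u ^ (3 : ℕ) + 2 * u ^ (4 : ℕ) + 38 * c * u ^ (4 : ℕ) + 120 * c ^ (2 : ℕ) * u ^ (4 : ℕ) + 120 * c ^ (3 : ℕ) * u ^ (4 : ℕ) + 38 * c ^ (4 : ℕ) * u ^ (4 : ℕ) + 2 * c ^ (5 : ℕ) * u ^ (4 : ℕ) + 6 * u ^ (5 : ℕ) + 40 * c * u ^ (5 : ℕ) + 68 * c ^ (2 : ℕ) * u ^ (5 : ℕ) + 40 * c ^ (3 : ℕ) * u ^ (5 : ℕ) + 6 * c ^ (4 : ℕ) * u ^ (5 : ℕ) + 4 * u ^ (6 : ℕ) + 12 * c * u ^ (6 : ℕ) + 12 * c ^ (2 : ℕ) * u ^ (6 : ℕ) + 4 * c ^ (3 : ℕ) * u ^ (6 : ℕ))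

/-- The polynomial `𝐑(c,u)` of the certificate (explicit; local notation, no definition). -/
local notation3 (prettyPrint := false) "𝐑⟦" c ", " u "⟧" => (8 * c ^ (3 : ℕ) * u + 16 * c ^ (4 : ℕ) * u + 8 * c ^ (5 : ℕ) * u + 16 * c ^ (2 : ℕ) * u ^ (2 : ℕ) + 96 * c ^ (3 : ℕ) * u ^ (2 : ℕ) + 96 * c ^ (4 : ℕ) * u ^ (2 : ℕ) + 16 * c ^ (5 : ℕ) * u ^ (2 : ℕ) + 10 * c * u ^ (3 : ℕ) + 144 * c ^ (2 : ℕ) * u ^ (3 : ℕ) + 332 * c ^ (3 : ℕ) * u ^ (3 : ℕ) + 144 * c ^ (4 : ℕ) * u ^ (3 : ℕ) + 10 * c ^ (5 : ℕ) * u ^ (3 : ℕ) + 2 * u ^ (4 : ℕ) + 78 * c * u ^ (4 : ℕ) + 400 * c ^ (2 : ℕ) * u ^ (4 : ℕ) + 400 * c ^ (3 : ℕ) * u ^ (4 : ℕ) + 78 * c ^ (4 : ℕ) * u ^ (4 : ℕ) + 2 * c ^ (5 : ℕ) * u ^ (4 : ℕ) + 14 * u ^ (5 : ℕ) + 184 *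 c * u ^ (5 : ℕ) + 404 * c ^ (2 : ℕ) * u ^ (5 : ℕ) + 184 * c ^ (3 : ℕ) * u ^ (5 : ℕ) + 14 * c ^ (4 : ℕ) * u ^ (5 : ℕ) + 28 * u ^ (6 : ℕ) + 148 * c * u ^ (6 : ℕ) + 148 * c ^ (2 : ℕ) * u ^ (6 : ℕ) + 28 * c ^ (3 : ℕ) * u ^ (6 : ℕ) + 16 * u ^ (7 : ℕ) + 32 * c * u ^ (7 : ℕ) + 16 * c ^ (2 : ℕ) * u ^ (7 : ℕ))

/-- `L₁(c,u) = 2c + (1+c)u`. -/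
local notation3 (prettyPrint := false) "𝐋₁⟦" c ", " u "⟧" => (2 * c + (1 + c) * u)
/-- `L₂(c,u) = (1+c) + 2u`. -/
local notation3 (prettyPrint := false) "𝐋₂⟦" c ", " u "⟧" => ((1 + c) + 2 * u)
/-- `G₁ = b₂·u·L₁ − a·u²·L₂` (so `W_j/Wₚ = G₁/((b₂−b₁)L₂)`). -/
local notation3 (prettyPrint := false) "𝐆₁⟦" a ", " b₂ ", " c ", " u "⟧" => (b₂ * u * (2 * c + (1 + c) * u) - a * u ^ 2 * ((1 + c) + 2 * u))
/-- `G₂ = a·u²·L₂ − b₁·u·L₁` (so `W_k/Wₚ = G₂/((b₂−b₁)L₂)`). -/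
local notation3 (prettyPrint := false) "𝐆₂⟦" a ", " b₁ ", " c ", " u "⟧" => (a * u ^ 2 * ((1 + c) + 2 * u) - b₁ * u * (2 * c + (1 + c) * u))
/-- `G₁′ = ∂G₁/∂u`. -/
local notation3 (prettyPrint := false) "𝐆₁'⟦" a ", " b₂ ", " c ", " u "⟧" => (b₂ * (2 * c + 2 * (1 + c) * u) - a * (2 * (1 + c) * u + 6 * u ^ 2))
/-- `G₂′ = ∂G₂/∂u`. -/
local notation3 (prettyPrint := false) "𝐆₂'⟦" a ", " b₁ ", " c ", " u "⟧" => (a * (2 * (1 + c) * u + 6 * u ^ 2) - b₁ * (2 * c + 2 * (1 + c) * u))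

/-! ## 1. The key polynomial identity -/

/-- **KEY IDENTITY.**  With `K_num := γ₂·(G₁′L₂ − 2G₁)·G₂ − γ₁·G₁·(G₂′L₂ − 2G₂)` (`L₂′ = 2`, `γ₁ = a + b₁`, `γ₂ = a + b₂`):
`L₁²·K_num = −(b₂ − b₁)·u·(b₁b₂·P − a(b₁+b₂)·Q + a²·R)`. [this file, `ring`] -/
theorem key_identity (a c b₁ b₂ u : ℝ) :
    (𝐋₁⟦c, u⟧) ^ 2 * ((a + b₂) * (𝐆₁'⟦a, b₂, c, u⟧ * 𝐋₂⟦c, u⟧ - 𝐆₁⟦a, b₂, c, u⟧ * 2) * 𝐆₂⟦a, b₁, c, u⟧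
        - (a + b₁) * 𝐆₁⟦a, b₂, c, u⟧ * (𝐆₂'⟦a, b₁, c, u⟧ * 𝐋₂⟦c, u⟧ - 𝐆₂⟦a, b₁, c, u⟧ * 2))
      = -(b₂ - b₁) * u * (b₁ * b₂ * 𝐏⟦c, u⟧ - a * (b₁ + b₂) * 𝐐⟦c, u⟧ + a ^ 2 * 𝐑⟦c, u⟧) := by
  ring

/-! ## 2. One critical point: the reduced coordinates `X₁ = (w_j/wₚ)x^{γ₁}`, `X₂ = (w_k/wₚ)x^{γ₂}` and `u` -/

/-- **COORDINATES OF A CRITICAL POINT.**  At a critical point `(x,T)` with `c < T` (positions `c < 1 = t_R`), put `X₁ = (w_j/wₚ)x^{γ₁}`,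
`X₂ = (w_k/wₚ)x^{γ₂}`, `u = √((b₁X₁ + b₂X₂)/a)`.  Then `u > 0`, `a u² = b₁X₁ + b₂X₂`, and `X₁·((b₂−b₁)L₂(u)) = G₁(u)`,
`X₂·((b₂−b₁)L₂(u)) = G₂(u)` (from `…ParallelReduction.parallel_eliminant`). [this file] -/
theorem critical_coords {wp wj wk c a b₁ b₂ : ℝ} {dp γ₁ γ₂ : ℕ} (hwp : 0 < wp) (hwj : 0 < wj) (hwk : 0 < wk)
    (hc : 0 < c) (hc1 : c < 1) (ha : 0 < a) (hb₁ : 0 < b₁) (hb₂ : 0 < b₂)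
    {x T : ℝ} (hx : 0 < x) (hT : c < T)
    (h1 : wp * x ^ dp * (T ^ 2 - c ^ 2) + (wj * x ^ (dp + γ₁) + wk * x ^ (dp + γ₂)) * (T ^ 2 - 1 ^ 2) = 0)
    (h2 : -a * (wp * x ^ dp) * (T - c) ^ 2 + (b₁ * (wj * x ^ (dp + γ₁)) + b₂ * (wk * x ^ (dp + γ₂))) * (T - 1) ^ 2 = 0) :
    0 < Real.sqrt ((b₁ * (wj / wp * x ^ γ₁) + b₂ * (wk / wp * x ^ γ₂)) / a)
    ∧ a * Real.sqrt ((b₁ * (wj / wp * x ^ γ₁) + b₂ * (wk / wp * x ^ γ₂)) / a) ^ 2 = b₁ * (wj / wp * x ^ γ₁) + b₂ * (wk / wp * x ^ γ₂)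
    ∧ (wj / wp * x ^ γ₁) * ((b₂ - b₁) * 𝐋₂⟦c, Real.sqrt ((b₁ * (wj / wp * x ^ γ₁) + b₂ * (wk / wp * x ^ γ₂)) / a)⟧)
        = 𝐆₁⟦a, b₂, c, Real.sqrt ((b₁ * (wj / wp * x ^ γ₁) + b₂ * (wk / wp * x ^ γ₂)) / a)⟧
    ∧ (wk / wp * x ^ γ₂) * ((b₂ - b₁) * 𝐋₂⟦c, Real.sqrt ((b₁ * (wj / wp * x ^ γ₁) + b₂ * (wk / wp * x ^ γ₂)) / a)⟧)
        = 𝐆₂⟦a, b₁, c, Real.sqrt ((b₁ * (wj / wp * x ^ γ₁) + b₂ * (wk / wp * x ^ γ₂)) / a)⟧ := by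
  set X₁ := wj / wp * x ^ γ₁ with hX₁
  set X₂ := wk / wp * x ^ γ₂ with hX₂
  have hX₁pos : 0 < X₁ := mul_pos (div_pos hwj hwp) (pow_pos hx _)
  have hX₂pos : 0 < X₂ := mul_pos (div_pos hwk hwp) (pow_pos hx _)
  set Wp := wp * x ^ dp with hWp
  have hWpos : 0 < Wp := mul_pos hwp (pow_pos hx _)
  have hR : wj * x ^ (dp + γ₁) + wk * x ^ (dp + γ₂) = Wp * (X₁ + X₂) := by
    rw [hX₁, hX₂, hWp, pow_add, pow_add]; field_simp
  have hRb : b₁ * (wj * x ^ (dp + γ₁)) + b₂ * (wk * x ^ (dp + γ₂)) = Wp * (b₁ * X₁ + b₂ * X₂) := by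
    rw [hX₁, hX₂, hWp, pow_add, pow_add]; field_simp
  set β := b₁ * X₁ + b₂ * X₂ with hβ
  have hβpos : 0 < β := by positivity
  set u := Real.sqrt (β / a) with hu
  have hupos : 0 < u := Real.sqrt_pos.2 (div_pos hβpos ha)
  have hu2 : a * u ^ 2 = β := by rw [hu, Real.sq_sqrt (div_pos hβpos ha).le]; field_simp
  -- T < 1 from the first equation
  have hT1 : T < 1 := by
    by_contra hge
    push Not at hge
    have h1' : Wp * (T ^ 2 - c ^ 2) + Wp * (X₁ + X₂) * (T ^ 2 - 1 ^ 2) = 0 := by rw [← hR]; exact h1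
    have hA : 0 < Wp * (T ^ 2 - c ^ 2) := mul_pos hWpos (by nlinarith)
    have hB : 0 ≤ Wp * (X₁ + X₂) * (T ^ 2 - 1 ^ 2) := mul_nonneg (mul_pos hWpos (by linarith)).le (by nlinarith)
    linarith
  -- the eliminant
  have h1' : Wp * (T ^ 2 - c ^ 2) + Wp * (X₁ + X₂) * (T ^ 2 - 1 ^ 2) = 0 := by rw [← hR]; exact h1
  have h2' : -a * Wp * (T - c) ^ 2 + Wp * β * (T - 1) ^ 2 = 0 := by
    have : -a * (wp * x ^ dp) * (T - c) ^ 2 = -a * Wp * (T - c) ^ 2 := by rw [hWp]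
    rw [← hRb]; linarith [h2, this]
  have helim := parallel_eliminant (R := Wp * (X₁ + X₂)) (Rb := Wp * β) (tp := c) (tR := 1) ha hWpos
    (mul_pos hWpos hβpos).le hc1 hT.le hT1.le h1' h2'
  -- √(Wpβ)/√(aWp) = u
  have hsq : Real.sqrt (Wp * β) / Real.sqrt (a * Wp) = u := by
    rw [hu, ← Real.sqrt_div (mul_pos hWpos hβpos).le]
    congr 1
    field_simp
  rw [hsq] at helim
  have hθ : Wp * (X₁ + X₂) / Wp = X₁ + X₂ := by field_simp
  rw [hθ] at helim
  -- helim : (X₁ + X₂) * ((1 + c) + 2 * u * 1) = u * (2 * c + u * (1 + c))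
  refine ⟨hupos, hu2, ?_, ?_⟩
  · linear_combination b₂ * helim + (𝐋₂⟦c, u⟧) * hu2 + (𝐋₂⟦c, u⟧) * hβ
  · linear_combination (-b₁) * helim - (𝐋₂⟦c, u⟧) * hu2 - (𝐋₂⟦c, u⟧) * hβ

/-! ## 3. The weight-free invariant and its derivative -/

/-- `u`-derivatives of `G₁`, `G₂`. [folklore] -/
theorem hasDerivAt_G₁ (a b₂ c u : ℝ) : HasDerivAt (fun v => 𝐆₁⟦a, b₂, c, v⟧) (𝐆₁'⟦a, b₂, c, u⟧) u := by
  have h := (((hasDerivAt_id' u).const_mul b₂).fun_mul ((hasDerivAt_id' u).const_mul (1 + c) |>.const_add (2 * c))).fun_sub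
    (((hasDerivAt_pow 2 u).const_mul a).fun_mul (((hasDerivAt_id' u).const_mul 2).const_add (1 + c)))
  exact h.congr_deriv (by simp; ring)

/-- `u`-derivative of `G₂`. [folklore] -/
theorem hasDerivAt_G₂ (a b₁ c u : ℝ) : HasDerivAt (fun v => 𝐆₂⟦a, b₁, c, v⟧) (𝐆₂'⟦a, b₁, c, u⟧) u := by
  have h := (((hasDerivAt_pow 2 u).const_mul a).fun_mul (((hasDerivAt_id' u).const_mul 2).const_add (1 + c))).fun_sub
    (((hasDerivAt_id' u).const_mul b₁).fun_mul ((hasDerivAt_id' u).const_mul (1 + c) |>.const_add (2 * c)))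
  exact h.congr_deriv (by simp; ring)

/-- `u`-derivative of `(b₂ − b₁)·L₂`. [folklore] -/
theorem hasDerivAt_DL₂ (b₁ b₂ c u : ℝ) : HasDerivAt (fun v => (b₂ - b₁) * 𝐋₂⟦c, v⟧) ((b₂ - b₁) * 2) u := by
  have h := (((hasDerivAt_id' u).const_mul 2).const_add (1 + c)).const_mul (b₂ - b₁)
  exact h.congr_deriv (by simp)

/-- **DERIVATIVE OF THE INVARIANT.**  `Φ(u) = F₁(u)^{γ₂}/F₂(u)^{γ₁}`, `Fᵢ = Gᵢ/((b₂−b₁)L₂)`, at a point where `F₂ ≠ 0` and `(b₂−b₁)L₂ ≠ 0`: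
`Φ′ = (γ₂F₁^{γ₂−1}F₁′·F₂^{γ₁} − F₁^{γ₂}·γ₁F₂^{γ₁−1}F₂′)/(F₂^{γ₁})²` with `Fᵢ′ = (Gᵢ′·(b₂−b₁)L₂ − Gᵢ·(b₂−b₁)·2)/((b₂−b₁)L₂)²`.
[folklore] -/
theorem hasDerivAt_invariant (a b₁ b₂ c : ℝ) (γ₁ γ₂ : ℕ) {u : ℝ} (hD : (b₂ - b₁) * 𝐋₂⟦c, u⟧ ≠ 0)
    (hF₂ : 𝐆₂⟦a, b₁, c, u⟧ / ((b₂ - b₁) * 𝐋₂⟦c, u⟧) ≠ 0) :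
    HasDerivAt (fun v => (𝐆₁⟦a, b₂, c, v⟧ / ((b₂ - b₁) * 𝐋₂⟦c, v⟧)) ^ γ₂ / (𝐆₂⟦a, b₁, c, v⟧ / ((b₂ - b₁) * 𝐋₂⟦c, v⟧)) ^ γ₁)
      (((γ₂ : ℝ) * (𝐆₁⟦a, b₂, c, u⟧ / ((b₂ - b₁) * 𝐋₂⟦c, u⟧)) ^ (γ₂ - 1)
            * ((𝐆₁'⟦a, b₂, c, u⟧ * ((b₂ - b₁) * 𝐋₂⟦c, u⟧) - 𝐆₁⟦a, b₂, c, u⟧ * ((b₂ - b₁) * 2)) / ((b₂ - b₁) * 𝐋₂⟦c, u⟧) ^ 2)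
            * (𝐆₂⟦a, b₁, c, u⟧ / ((b₂ - b₁) * 𝐋₂⟦c, u⟧)) ^ γ₁
          - (𝐆₁⟦a, b₂, c, u⟧ / ((b₂ - b₁) * 𝐋₂⟦c, u⟧)) ^ γ₂
            * ((γ₁ : ℝ) * (𝐆₂⟦a, b₁, c, u⟧ / ((b₂ - b₁) * 𝐋₂⟦c, u⟧)) ^ (γ₁ - 1)
              * ((𝐆₂'⟦a, b₁, c, u⟧ * ((b₂ - b₁) * 𝐋₂⟦c, u⟧) - 𝐆₂⟦a, b₁, c, u⟧ * ((b₂ - b₁) * 2)) / ((b₂ - b₁) * 𝐋₂⟦c, u⟧) ^ 2)))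
        / ((𝐆₂⟦a, b₁, c, u⟧ / ((b₂ - b₁) * 𝐋₂⟦c, u⟧)) ^ γ₁) ^ 2) u := by
  have hF₁ := (hasDerivAt_G₁ a b₂ c u).fun_div (hasDerivAt_DL₂ b₁ b₂ c u) hD
  have hF₂d := (hasDerivAt_G₂ a b₁ c u).fun_div (hasDerivAt_DL₂ b₁ b₂ c u) hD
  exact (hF₁.pow γ₂).fun_div (hF₂d.pow γ₁) (pow_ne_zero _ hF₂)

/-! ## 4. Auxiliary monotonicity and positivity facts -/

/-- `u` increases with the scale: if `a·u_x² = b₁c_jx^{γ₁} + b₂c_kx^{γ₂}` (positive data, `γᵢ ≥ 1`) then `x < y ⇒ u_x < u_y`. [folklore] -/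
theorem u_strictMono {a b₁ b₂ cj ck x y ux uy : ℝ} {γ₁ γ₂ : ℕ} (ha : 0 < a) (hb₁ : 0 < b₁) (hb₂ : 0 < b₂) (hcj : 0 < cj)
    (hck : 0 < ck) (hγ₁ : γ₁ ≠ 0) (hγ₂ : γ₂ ≠ 0) (hx : 0 < x) (hxy : x < y) (huy : 0 < uy)
    (ex : a * ux ^ 2 = b₁ * (cj * x ^ γ₁) + b₂ * (ck * x ^ γ₂)) (ey : a * uy ^ 2 = b₁ * (cj * y ^ γ₁) + b₂ * (ck * y ^ γ₂)) :
    ux < uy := by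
  have h1 : x ^ γ₁ < y ^ γ₁ := pow_lt_pow_left₀ hxy hx.le hγ₁
  have h2 : x ^ γ₂ < y ^ γ₂ := pow_lt_pow_left₀ hxy hx.le hγ₂
  have e1 := mul_lt_mul_of_pos_left h1 (mul_pos hb₁ hcj)
  have e2 := mul_lt_mul_of_pos_left h2 (mul_pos hb₂ hck)
  have hlt : a * ux ^ 2 < a * uy ^ 2 := by rw [ex, ey]; linarith only [e1, e2]
  have : ux ^ 2 < uy ^ 2 := lt_of_mul_lt_mul_left hlt ha.le
  exact lt_of_pow_lt_pow_left₀ 2 huy.le this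

/-- `G₂ > 0` propagates UPWARD in `u` (`G₂(u)/u = 2au² + (a − b₁)(1+c)u − 2cb₁` is increasing). [this file] -/
theorem G₂_pos_of_le {a b₁ c u₁ v : ℝ} (ha : 0 < a) (hb₁ : 0 < b₁) (hc : 0 < c) (hu₁ : 0 < u₁) (hv : u₁ ≤ v)
    (h : 0 < 𝐆₂⟦a, b₁, c, u₁⟧) : 0 < 𝐆₂⟦a, b₁, c, v⟧ := by
  have hvpos : 0 < v := hu₁.trans_le hv
  have key : 𝐆₂⟦a, b₁, c, v⟧ * u₁ ^ 2 - 𝐆₂⟦a, b₁, c, u₁⟧ * v ^ 2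
      = u₁ * v * ((v - u₁) * (2 * a * u₁ * v + 2 * c * b₁)) := by ring
  have hrhs : 0 ≤ u₁ * v * ((v - u₁) * (2 * a * u₁ * v + 2 * c * b₁)) :=
    mul_nonneg (mul_pos hu₁ hvpos).le (mul_nonneg (sub_nonneg.2 hv) (by positivity))
  have h2 : 0 < 𝐆₂⟦a, b₁, c, u₁⟧ * v ^ 2 := mul_pos h (pow_pos hvpos 2)
  have h3 : 0 < 𝐆₂⟦a, b₁, c, v⟧ * u₁ ^ 2 := by linarith only [key, hrhs, h2]
  exact pos_of_mul_pos_left h3 (pow_pos hu₁ 2).le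

/-- `G₁ > 0` propagates DOWNWARD in `u` (`G₁(u)/u = 2cb₂ + (b₂ − a)(1+c)u − 2au²` is decreasing). [this file] -/
theorem G₁_pos_of_le {a b₂ c u₄ v : ℝ} (ha : 0 < a) (hb₂ : 0 < b₂) (hc : 0 < c) (hu₄ : 0 < u₄) (hvpos : 0 < v) (hv : v ≤ u₄)
    (h : 0 < 𝐆₁⟦a, b₂, c, u₄⟧) : 0 < 𝐆₁⟦a, b₂, c, v⟧ := by
  have key : 𝐆₁⟦a, b₂, c, v⟧ * u₄ ^ 2 - 𝐆₁⟦a, b₂, c, u₄⟧ * v ^ 2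
      = u₄ * v * ((u₄ - v) * (2 * a * u₄ * v + 2 * c * b₂)) := by ring
  have hrhs : 0 ≤ u₄ * v * ((u₄ - v) * (2 * a * u₄ * v + 2 * c * b₂)) :=
    mul_nonneg (mul_pos hu₄ hvpos).le (mul_nonneg (sub_nonneg.2 hv) (by positivity))
  have h2 : 0 < 𝐆₁⟦a, b₂, c, u₄⟧ * v ^ 2 := mul_pos h (pow_pos hvpos 2)
  have h3 : 0 < 𝐆₁⟦a, b₂, c, v⟧ * u₄ ^ 2 := by linarith only [key, hrhs, h2]
  exact pos_of_mul_pos_left h3 (pow_pos hu₄ 2).le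

/-- **FROM `Φ′(σ) = 0` TO THE CERTIFICATE'S COMBINATION.**  If the derivative of the invariant vanishes at `σ > 0` where `G₁, G₂ > 0`, then
`b₁b₂·P(c,σ) − a(b₁+b₂)·Q(c,σ) + a²·R(c,σ) = 0` (via `key_identity`). [this file] -/
theorem comb_zero_of_deriv_zero {a b₁ b₂ c σ : ℝ} {γ₁ γ₂ : ℕ} (hγ₁ : (γ₁ : ℝ) = a + b₁) (hγ₂ : (γ₂ : ℝ) = a + b₂)
    (hγ₁p : 1 ≤ γ₁) (hγ₂p : 1 ≤ γ₂) (hD : 0 < b₂ - b₁) (hσ : 0 < σ) (hc : 0 < c)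
    (hG1 : 0 < 𝐆₁⟦a, b₂, c, σ⟧) (hG2 : 0 < 𝐆₂⟦a, b₁, c, σ⟧)
    (e : ((γ₂ : ℝ) * (𝐆₁⟦a, b₂, c, σ⟧ / ((b₂ - b₁) * 𝐋₂⟦c, σ⟧)) ^ (γ₂ - 1)
            * ((𝐆₁'⟦a, b₂, c, σ⟧ * ((b₂ - b₁) * 𝐋₂⟦c, σ⟧) - 𝐆₁⟦a, b₂, c, σ⟧ * ((b₂ - b₁) * 2)) / ((b₂ - b₁) * 𝐋₂⟦c, σ⟧) ^ 2)
            * (𝐆₂⟦a, b₁, c, σ⟧ / ((b₂ - b₁) * 𝐋₂⟦c, σ⟧)) ^ γ₁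
          - (𝐆₁⟦a, b₂, c, σ⟧ / ((b₂ - b₁) * 𝐋₂⟦c, σ⟧)) ^ γ₂
            * ((γ₁ : ℝ) * (𝐆₂⟦a, b₁, c, σ⟧ / ((b₂ - b₁) * 𝐋₂⟦c, σ⟧)) ^ (γ₁ - 1)
              * ((𝐆₂'⟦a, b₁, c, σ⟧ * ((b₂ - b₁) * 𝐋₂⟦c, σ⟧) - 𝐆₂⟦a, b₁, c, σ⟧ * ((b₂ - b₁) * 2)) / ((b₂ - b₁) * 𝐋₂⟦c, σ⟧) ^ 2)))
        / ((𝐆₂⟦a, b₁, c, σ⟧ / ((b₂ - b₁) * 𝐋₂⟦c, σ⟧)) ^ γ₁) ^ 2 = 0) :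
    (b₁ * b₂) * 𝐏⟦c, σ⟧ + (-(a * (b₁ + b₂))) * 𝐐⟦c, σ⟧ + a ^ 2 * 𝐑⟦c, σ⟧ = 0 := by
  have hL : 0 < 𝐋₂⟦c, σ⟧ := by positivity
  have hkey := key_identity a c b₁ b₂ σ
  obtain ⟨m, hm⟩ : ∃ m, γ₂ = m + 1 := ⟨γ₂ - 1, by omega⟩
  obtain ⟨n, hn⟩ : ∃ n, γ₁ = n + 1 := ⟨γ₁ - 1, by omega⟩
  have hγ₂' : ((m : ℝ) + 1) = a + b₂ := by rw [← hγ₂, hm]; push_cast; ring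
  have hγ₁' : ((n : ℝ) + 1) = a + b₁ := by rw [← hγ₁, hn]; push_cast; ring
  subst hm; subst hn
  simp only [Nat.add_sub_cancel] at e
  push_cast at e
  -- abstract the polynomial values
  generalize hg1 : 𝐆₁⟦a, b₂, c, σ⟧ = g1 at e hG1 hkey
  generalize hg2 : 𝐆₂⟦a, b₁, c, σ⟧ = g2 at e hG2 hkey
  generalize hg1' : 𝐆₁'⟦a, b₂, c, σ⟧ = g1' at e hkey
  generalize hg2' : 𝐆₂'⟦a, b₁, c, σ⟧ = g2' at e hkey
  generalize hl2 : 𝐋₂⟦c, σ⟧ = l2 at e hL hkey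
  generalize hl1 : 𝐋₁⟦c, σ⟧ = l1 at hkey
  generalize hTT : (b₁ * b₂ * 𝐏⟦c, σ⟧ - a * (b₁ + b₂) * 𝐐⟦c, σ⟧ + a ^ 2 * 𝐑⟦c, σ⟧) = TT at hkey
  set D := b₂ - b₁ with hDdef
  have hDl : D * l2 ≠ 0 := (mul_pos hD hL).ne'
  have hF₁ : 0 < g1 / (D * l2) := div_pos hG1 (mul_pos hD hL)
  have hF₂ : 0 < g2 / (D * l2) := div_pos hG2 (mul_pos hD hL)
  rw [div_eq_zero_iff] at e
  rcases e with e | e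
  swap
  · exact absurd e (pow_ne_zero _ (pow_ne_zero _ hF₂.ne'))
  -- e : (m+1) F₁^m F₁' F₂^(n+1) − F₁^(m+1) (n+1) F₂^n F₂' = 0 ; factor F₁^m F₂^n
  rw [pow_succ (g1 / (D * l2)) m, pow_succ (g2 / (D * l2)) n] at e
  have hfac : ((m : ℝ) + 1) * (g1 / (D * l2)) ^ m * ((g1' * (D * l2) - g1 * (D * 2)) / (D * l2) ^ 2) * ((g2 / (D * l2)) ^ n * (g2 / (D * l2)))
      - (g1 / (D * l2)) ^ m * (g1 / (D * l2)) * (((n : ℝ) + 1) * (g2 / (D * l2)) ^ n * ((g2' * (D * l2) - g2 * (D * 2)) / (D * l2) ^ 2))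
      = ((g1 / (D * l2)) ^ m * (g2 / (D * l2)) ^ n / ((D * l2) ^ 2 * (D * l2)))
        * (((m : ℝ) + 1) * (g1' * (D * l2) - g1 * (D * 2)) * g2 - ((n : ℝ) + 1) * g1 * (g2' * (D * l2) - g2 * (D * 2))) := by
    field_simp
  rw [hfac] at e
  have hpos : (g1 / (D * l2)) ^ m * (g2 / (D * l2)) ^ n / ((D * l2) ^ 2 * (D * l2)) ≠ 0 := by positivity
  have hKnum : ((m : ℝ) + 1) * (g1' * (D * l2) - g1 * (D * 2)) * g2 - ((n : ℝ) + 1) * g1 * (g2' * (D * l2) - g2 * (D * 2)) = 0 := by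
    rcases mul_eq_zero.1 e with h | h
    · exact absurd h hpos
    · exact h
  have hK : (a + b₂) * (g1' * l2 - g1 * 2) * g2 - (a + b₁) * g1 * (g2' * l2 - g2 * 2) = 0 := by
    rw [← hγ₂', ← hγ₁']
    have : ((m : ℝ) + 1) * (g1' * (D * l2) - g1 * (D * 2)) * g2 - ((n : ℝ) + 1) * g1 * (g2' * (D * l2) - g2 * (D * 2))
        = D * (((m : ℝ) + 1) * (g1' * l2 - g1 * 2) * g2 - ((n : ℝ) + 1) * g1 * (g2' * l2 - g2 * 2)) := by ring
    rw [this] at hKnum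
    rcases mul_eq_zero.1 hKnum with h | h
    · exact absurd h hD.ne'
    · exact h
  have hz : -(b₂ - b₁) * σ * TT = 0 := by rw [← hkey, hK]; ring
  have hTT0 : TT = 0 := by
    rcases mul_eq_zero.1 hz with h | h
    · rcases mul_eq_zero.1 h with h | h
      · exact absurd (neg_eq_zero.1 h) hD.ne'
      · exact absurd h hσ.ne'
    · exact h
  rw [← hTT] at hTT0
  linarith only [hTT0]

/-! ## 5. The law -/

/-- **THE PARALLEL TWO-LETTER PER-SIDE LAW.**  Pivot letter (weight `wₚ > 0`, position `c ∈ (0,1)`, exponent `dₚ`), two parallel letters at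
position `1` (weights `w_j, w_k > 0`, exponents `dₚ + γ₁`, `dₚ + γ₂`), rates `a > 0`, `0 < b₁ < b₂` with `γ₁ = a + b₁`, `γ₂ = a + b₂` (as reals):
the window profile has NO FOUR critical points `(xᵢ, Tᵢ)` with `c < Tᵢ` and scales `x₁ < x₂ < x₃ < x₄`.  Hence at most three critical directions
beyond the pivot letter (`RootCount.critical_x_unique`: distinct critical points have distinct scales). [this file] -/
theorem parallel_two_law {wp wj wk c a b₁ b₂ : ℝ} {dp γ₁ γ₂ : ℕ} (hwp : 0 < wp) (hwj : 0 < wj) (hwk : 0 < wk)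
    (hc : 0 < c) (hc1 : c < 1) (ha : 0 < a) (hb₁ : 0 < b₁) (hb₁₂ : b₁ < b₂) (hγ₁ : (γ₁ : ℝ) = a + b₁) (hγ₂ : (γ₂ : ℝ) = a + b₂)
    {x₁ x₂ x₃ x₄ T₁ T₂ T₃ T₄ : ℝ} (hx₁ : 0 < x₁) (h₁₂ : x₁ < x₂) (h₂₃ : x₂ < x₃) (h₃₄ : x₃ < x₄)
    (hT₁ : c < T₁) (hT₂ : c < T₂) (hT₃ : c < T₃) (hT₄ : c < T₄)
    (c₁ : wp * x₁ ^ dp * (T₁ ^ 2 - c ^ 2) + (wj * x₁ ^ (dp + γ₁) + wk * x₁ ^ (dp + γ₂)) * (T₁ ^ 2 - 1 ^ 2) = 0)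
    (c₁' : -a * (wp * x₁ ^ dp) * (T₁ - c) ^ 2 + (b₁ * (wj * x₁ ^ (dp + γ₁)) + b₂ * (wk * x₁ ^ (dp + γ₂))) * (T₁ - 1) ^ 2 = 0)
    (c₂ : wp * x₂ ^ dp * (T₂ ^ 2 - c ^ 2) + (wj * x₂ ^ (dp + γ₁) + wk * x₂ ^ (dp + γ₂)) * (T₂ ^ 2 - 1 ^ 2) = 0)
    (c₂' : -a * (wp * x₂ ^ dp) * (T₂ - c) ^ 2 + (b₁ * (wj * x₂ ^ (dp + γ₁)) + b₂ * (wk * x₂ ^ (dp + γ₂))) * (T₂ - 1) ^ 2 = 0)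
    (c₃ : wp * x₃ ^ dp * (T₃ ^ 2 - c ^ 2) + (wj * x₃ ^ (dp + γ₁) + wk * x₃ ^ (dp + γ₂)) * (T₃ ^ 2 - 1 ^ 2) = 0)
    (c₃' : -a * (wp * x₃ ^ dp) * (T₃ - c) ^ 2 + (b₁ * (wj * x₃ ^ (dp + γ₁)) + b₂ * (wk * x₃ ^ (dp + γ₂))) * (T₃ - 1) ^ 2 = 0)
    (c₄ : wp * x₄ ^ dp * (T₄ ^ 2 - c ^ 2) + (wj * x₄ ^ (dp + γ₁) + wk * x₄ ^ (dp + γ₂)) * (T₄ ^ 2 - 1 ^ 2) = 0)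
    (c₄' : -a * (wp * x₄ ^ dp) * (T₄ - c) ^ 2 + (b₁ * (wj * x₄ ^ (dp + γ₁)) + b₂ * (wk * x₄ ^ (dp + γ₂))) * (T₄ - 1) ^ 2 = 0) :
    False := by
  have hb₂ : 0 < b₂ := hb₁.trans hb₁₂
  have hD : 0 < b₂ - b₁ := sub_pos.2 hb₁₂
  have hγ₁p : 1 ≤ γ₁ := by
    have : (0 : ℝ) < γ₁ := by rw [hγ₁]; linarith
    have : 0 < γ₁ := by exact_mod_cast this
    omega
  have hγ₂p : 1 ≤ γ₂ := by
    have : (0 : ℝ) < γ₂ := by rw [hγ₂]; linarith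
    have : 0 < γ₂ := by exact_mod_cast this
    omega
  have hx₂ : 0 < x₂ := hx₁.trans h₁₂
  have hx₃ : 0 < x₃ := hx₂.trans h₂₃
  have hx₄ : 0 < x₄ := hx₃.trans h₃₄
  obtain ⟨hu₁, hsq₁, hG₁₁, hG₂₁⟩ := critical_coords hwp hwj hwk hc hc1 ha hb₁ hb₂ hx₁ hT₁ c₁ c₁'
  obtain ⟨hu₂, hsq₂, hG₁₂, hG₂₂⟩ := critical_coords hwp hwj hwk hc hc1 ha hb₁ hb₂ hx₂ hT₂ c₂ c₂'
  obtain ⟨hu₃, hsq₃, hG₁₃, hG₂₃⟩ := critical_coords hwp hwj hwk hc hc1 ha hb₁ hb₂ hx₃ hT₃ c₃ c₃'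
  obtain ⟨hu₄, hsq₄, hG₁₄, hG₂₄⟩ := critical_coords hwp hwj hwk hc hc1 ha hb₁ hb₂ hx₄ hT₄ c₄ c₄'
  set u₁ := Real.sqrt ((b₁ * (wj / wp * x₁ ^ γ₁) + b₂ * (wk / wp * x₁ ^ γ₂)) / a) with hu₁def
  set u₂ := Real.sqrt ((b₁ * (wj / wp * x₂ ^ γ₁) + b₂ * (wk / wp * x₂ ^ γ₂)) / a) with hu₂def
  set u₃ := Real.sqrt ((b₁ * (wj / wp * x₃ ^ γ₁) + b₂ * (wk / wp * x₃ ^ γ₂)) / a) with hu₃def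
  set u₄ := Real.sqrt ((b₁ * (wj / wp * x₄ ^ γ₁) + b₂ * (wk / wp * x₄ ^ γ₂)) / a) with hu₄def
  have hcj : 0 < wj / wp := div_pos hwj hwp
  have hck : 0 < wk / wp := div_pos hwk hwp
  have hγ₁0 : γ₁ ≠ 0 := by omega
  have hγ₂0 : γ₂ ≠ 0 := by omega
  have hu₁₂ : u₁ < u₂ := u_strictMono ha hb₁ hb₂ hcj hck hγ₁0 hγ₂0 hx₁ h₁₂ hu₂ hsq₁ hsq₂
  have hu₂₃ : u₂ < u₃ := u_strictMono ha hb₁ hb₂ hcj hck hγ₁0 hγ₂0 hx₂ h₂₃ hu₃ hsq₂ hsq₃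
  have hu₃₄ : u₃ < u₄ := u_strictMono ha hb₁ hb₂ hcj hck hγ₁0 hγ₂0 hx₃ h₃₄ hu₄ hsq₃ hsq₄
  have hL₂ : ∀ v, 0 < v → 0 < 𝐋₂⟦c, v⟧ := fun v hv => by positivity
  have hDL₂ : ∀ v, 0 < v → (b₂ - b₁) * 𝐋₂⟦c, v⟧ ≠ 0 := fun v hv => (mul_pos hD (hL₂ v hv)).ne'
  have hG₂u₁ : 0 < 𝐆₂⟦a, b₁, c, u₁⟧ := by
    rw [← hG₂₁]; exact mul_pos (mul_pos hck (pow_pos hx₁ _)) (mul_pos hD (hL₂ u₁ hu₁))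
  have hG₁u₄ : 0 < 𝐆₁⟦a, b₂, c, u₄⟧ := by
    rw [← hG₁₄]; exact mul_pos (mul_pos hcj (pow_pos hx₄ _)) (mul_pos hD (hL₂ u₄ hu₄))
  have hG₂pos : ∀ v, u₁ ≤ v → 0 < 𝐆₂⟦a, b₁, c, v⟧ := fun v hv => G₂_pos_of_le ha hb₁ hc hu₁ hv hG₂u₁
  have hG₁pos : ∀ v, 0 < v → v ≤ u₄ → 0 < 𝐆₁⟦a, b₂, c, v⟧ := fun v hv hv' => G₁_pos_of_le ha hb₂ hc hu₄ hv hv' hG₁u₄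
  -- the invariant and its values
  set Φ : ℝ → ℝ := fun v => (𝐆₁⟦a, b₂, c, v⟧ / ((b₂ - b₁) * 𝐋₂⟦c, v⟧)) ^ γ₂ / (𝐆₂⟦a, b₁, c, v⟧ / ((b₂ - b₁) * 𝐋₂⟦c, v⟧)) ^ γ₁
    with hΦ
  have hΦval : ∀ {x u : ℝ}, 0 < x → 0 < u →
      (wj / wp * x ^ γ₁) * ((b₂ - b₁) * 𝐋₂⟦c, u⟧) = 𝐆₁⟦a, b₂, c, u⟧ →
      (wk / wp * x ^ γ₂) * ((b₂ - b₁) * 𝐋₂⟦c, u⟧) = 𝐆₂⟦a, b₁, c, u⟧ →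
      Φ u = (wj / wp) ^ γ₂ / (wk / wp) ^ γ₁ := by
    intro x u hx hu e1 e2
    have hden := hDL₂ u hu
    have hF₁ : 𝐆₁⟦a, b₂, c, u⟧ / ((b₂ - b₁) * 𝐋₂⟦c, u⟧) = wj / wp * x ^ γ₁ := by rw [div_eq_iff hden, e1]
    have hF₂ : 𝐆₂⟦a, b₁, c, u⟧ / ((b₂ - b₁) * 𝐋₂⟦c, u⟧) = wk / wp * x ^ γ₂ := by rw [div_eq_iff hden, e2]
    simp only [hΦ, hF₁, hF₂, mul_pow, ← pow_mul]
    rw [mul_comm γ₁ γ₂]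
    have hxpow : x ^ (γ₂ * γ₁) ≠ 0 := pow_ne_zero _ hx.ne'
    have hwk' : (wk / wp) ^ γ₁ ≠ 0 := pow_ne_zero _ hck.ne'
    field_simp
  have eΦ₁ := hΦval hx₁ hu₁ hG₁₁ hG₂₁
  have eΦ₂ := hΦval hx₂ hu₂ hG₁₂ hG₂₂
  have eΦ₃ := hΦval hx₃ hu₃ hG₁₃ hG₂₃
  have eΦ₄ := hΦval hx₄ hu₄ hG₁₄ hG₂₄
  set Φ' : ℝ → ℝ := fun u =>
      ((γ₂ : ℝ) * (𝐆₁⟦a, b₂, c, u⟧ / ((b₂ - b₁) * 𝐋₂⟦c, u⟧)) ^ (γ₂ - 1)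
            * ((𝐆₁'⟦a, b₂, c, u⟧ * ((b₂ - b₁) * 𝐋₂⟦c, u⟧) - 𝐆₁⟦a, b₂, c, u⟧ * ((b₂ - b₁) * 2)) / ((b₂ - b₁) * 𝐋₂⟦c, u⟧) ^ 2)
            * (𝐆₂⟦a, b₁, c, u⟧ / ((b₂ - b₁) * 𝐋₂⟦c, u⟧)) ^ γ₁
          - (𝐆₁⟦a, b₂, c, u⟧ / ((b₂ - b₁) * 𝐋₂⟦c, u⟧)) ^ γ₂
            * ((γ₁ : ℝ) * (𝐆₂⟦a, b₁, c, u⟧ / ((b₂ - b₁) * 𝐋₂⟦c, u⟧)) ^ (γ₁ - 1)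
              * ((𝐆₂'⟦a, b₁, c, u⟧ * ((b₂ - b₁) * 𝐋₂⟦c, u⟧) - 𝐆₂⟦a, b₁, c, u⟧ * ((b₂ - b₁) * 2)) / ((b₂ - b₁) * 𝐋₂⟦c, u⟧) ^ 2)))
        / ((𝐆₂⟦a, b₁, c, u⟧ / ((b₂ - b₁) * 𝐋₂⟦c, u⟧)) ^ γ₁) ^ 2 with hΦ'
  have hΦder : ∀ v, u₁ ≤ v → HasDerivAt Φ (Φ' v) v := by
    intro v hv
    have hvpos : 0 < v := hu₁.trans_le hv
    have hF₂ne : 𝐆₂⟦a, b₁, c, v⟧ / ((b₂ - b₁) * 𝐋₂⟦c, v⟧) ≠ 0 := (div_pos (hG₂pos v hv) (mul_pos hD (hL₂ v hvpos))).ne'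
    exact hasDerivAt_invariant a b₁ b₂ c γ₁ γ₂ (hDL₂ v hvpos) hF₂ne
  have rolle : ∀ α β, u₁ ≤ α → α < β → Φ α = Φ β → ∃ σ ∈ Ioo α β, Φ' σ = 0 := by
    intro α β hα hαβ e
    have hcont : ContinuousOn Φ (Icc α β) := fun v hv => (hΦder v (hα.trans hv.1)).continuousAt.continuousWithinAt
    exact exists_hasDerivAt_eq_zero hαβ hcont e (fun v hv => hΦder v (hα.trans hv.1.le))
  obtain ⟨σ₁, hσ₁, e₁⟩ := rolle u₁ u₂ le_rfl hu₁₂ (eΦ₁.trans eΦ₂.symm)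
  obtain ⟨σ₂, hσ₂, e₂⟩ := rolle u₂ u₃ hu₁₂.le hu₂₃ (eΦ₂.trans eΦ₃.symm)
  obtain ⟨σ₃, hσ₃, e₃⟩ := rolle u₃ u₄ (hu₁₂.trans hu₂₃).le hu₃₄ (eΦ₃.trans eΦ₄.symm)
  have hT : ∀ σ, u₁ < σ → σ < u₄ → Φ' σ = 0 →
      (b₁ * b₂) * 𝐏⟦c, σ⟧ + (-(a * (b₁ + b₂))) * 𝐐⟦c, σ⟧ + a ^ 2 * 𝐑⟦c, σ⟧ = 0 := by
    intro σ h1 h4 e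
    have hσpos : 0 < σ := hu₁.trans h1
    exact comb_zero_of_deriv_zero hγ₁ hγ₂ hγ₁p hγ₂p hD hσpos hc (hG₁pos σ hσpos h4.le) (hG₂pos σ h1.le) e
  exact no_three_zeros hc (b₁ * b₂) (-(a * (b₁ + b₂))) (a ^ 2) (pow_ne_zero 2 ha.ne') (hu₁.trans hσ₁.1)
    (hσ₁.2.trans hσ₂.1) (hσ₂.2.trans hσ₃.1)
    (hT σ₁ hσ₁.1 (hσ₁.2.trans (hu₂₃.trans hu₃₄)) e₁)
    (hT σ₂ (hu₁₂.trans hσ₂.1) (hσ₂.2.trans hu₃₄) e₂)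
    (hT σ₃ ((hu₁₂.trans hu₂₃).trans hσ₃.1) hσ₃.2 e₃)

end Summit.ValiantsHypothesis.ValiantsHypothesis.Theorems.LacunarySymmetroidMatrixDescartes.Pivot.CriticalWindows.ParallelTwo
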